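import Literature.LinearAlgebra.Matrix.NonderogatoryCommutantBaseChange
import Mathlib.RingTheory.LocalRing.ResidueField.Basic
import HarnessLib

/-!
# Integral conjugacy of regular matrices over a local ring: two matrices over `𝒪` with the same characteristic polynomial,
# separable modulo `𝔪`, are `GL_N(𝒪)`-conjugate; hence `y g y⁻¹ ∈ M_N(𝒪) ⇒ y ∈ GL_N(𝒪) · Z(g)` (Kottwitz's orbit lemma for `GL_N`)
(Kottwitz, *Stable trace formula: elliptic singular terms* (1986), Prop. 7.1, the case `G = GL_N`, `K = GL_N(𝒪)`; mechanism:
Horn–Johnson, *Matrix Analysis* (2013), Thm. 3.3.15 — a nonderogatory matrix is similar to the companion matrix of its characteristic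
polynomial — run over a local ring by lifting a residual cyclic vector)

Topic `LinearAlgebra/Matrix`; namespace `Literature.LinearAlgebra.Matrix`; THEOREMS ONLY (no definition, no instance, no named fact, no
`sorry`), on top of ★ `CompanionMatrix` ∕ ★ `CyclicVectorCompanionMatrix` (the FIELD statements) and ★ `NonderogatoryCommutantBaseChange`
(`minpoly_eq_charpoly_of_charpoly_separable`).  Mathlib-only beyond those.

WHY (consumer: the floor-0 ENGINE line `F0_T1InnerFormTraceIdentity`, named fact ★-to-be `UnitaryGroup.UnramifiedOrbitSetAE` of
`Automorphic/UnramifiedOrbitalUnitFactor`, repayment instalment (F1) of its census).  The unramified local orbital integrals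
`Φ_v(γ_v, 1_{K_v})` equal `1` for almost all `v` because `{y ∣ y γ_v y⁻¹ ∈ K_v} = K_v · Z(γ_v)` (Kottwitz's Prop. 7.1); for `GL_N` with
`K = GL_N(𝒪)` this is LATTICE-FREE linear algebra: if `g ∈ M_N(𝒪)` has characteristic polynomial separable MODULO `𝔪`, a residual cyclic
vector lifts (Nakayama for `det`) to an integral Krylov basis in which `g` IS the companion matrix of `p_g`; so any two such matrices with the
same characteristic polynomial are conjugate by an element of `GL_N(𝒪)`, and an element `y` conjugating `g` into `M_N(𝒪)` differs from an
element of `GL_N(𝒪)` by an element of the centraliser of `g`.  At the SPLIT places of a CM extension this IS the unitary statement (★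
`localSplitEquiv : U(J)(F_v) ≃ₜ* GL_N(E_w)`, ★ `mem_localIntegralLevel_iff_of_ne`).

* §1 (any commutative ring `R`, `Nontrivial` where the characteristic polynomial is unfolded): `charpoly_eq_X_pow_add_sum_ring`
  (`p_A = X^m + Σ_{i<m} c_i X^i`), `mul_companion_apply_ring`, **`mul_krylov_eq_krylov_mul_companion_ring`** — for ANY vector `v`, the Krylov matrix
  `Kry(A, v) = [v | Av | ⋯ | A^{m−1}v]` satisfies `A · Kry(A, v) = Kry(A, v) · C(p_A)` (Cayley–Hamilton).
* §2 (`𝒪` a LOCAL commutative ring, residue field `k = 𝒪/𝔪`): **`exists_isUnit_det_mul_eq_mul_companion_of_separable`** — `g ∈ M_m(𝒪)` with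
  `(p_g mod 𝔪)` separable admits `S ∈ GL_m(𝒪)` with `g S = S C(p_g)` (a cyclic vector of `ḡ` over `k`, ★ `exists_forall_aeval_apply_eq_zero_imp`, lifted;
  `det S` is a unit because its residue is); **`exists_isUnit_det_conj_of_charpoly_eq`** — two such matrices with equal characteristic polynomials are
  `GL_m(𝒪)`-conjugate: `g′ P = P g`, `P ∈ GL_m(𝒪)`; **`exists_eq_aeval_of_commute_of_separable`** — the INTEGRAL commutant of such a `g` is
  `𝒪[g]` (every `X ∈ M_m(𝒪)` commuting with `g` is `p(g)`, `p ∈ 𝒪[X]`, `deg p < m`), hence commutative (`commute_of_commute_of_separable`) — the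
  interface of the unitary upgrade (norm surjectivity on the commutant order `𝒪[γ]`).
* §3 (`f : 𝒪 →+* F` injective into any commutative ring — e.g. `𝒪 ↪ Frac 𝒪`, `𝒪_w ↪ E_w`): **`exists_isUnit_det_map_mul_of_conj`** — if `y ∈ GL_m(F)`
  conjugates `g ⊗ 1` to some `g′ ⊗ 1`, `g′ ∈ M_m(𝒪)`, then `y = (k ⊗ 1) · z` with `k ∈ GL_m(𝒪)` and `z` commuting with `g ⊗ 1`; and the subgroup
  form **`mem_range_map_mul_centralizer_of_conj_mem_range`** — in `GL_m(F)`: `y (g ⊗ 1) y⁻¹ ∈ im GL_m(𝒪) ⇒ y ∈ im GL_m(𝒪) · Z(g ⊗ 1)` — Kottwitz's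
  Prop. 7.1 for `GL_m`, with «`1 − α(γ)` a unit or zero for every root» in the form «`p_γ` separable modulo `𝔪`» (regular semisimple reduction).

## References
* R. E. Kottwitz, *Stable trace formula: elliptic singular terms*, Math. Ann. 275 (1986), §7, Prop. 7.1 [Kottwitz1986].
* R. A. Horn, C. R. Johnson, *Matrix Analysis*, 2nd ed. (CUP 2013), Thm. 3.3.15 p. 257 (print: p0257 of the held text), (3.3.12) p. 256
  [HornJohnson2013].
* T. W. Hungerford, *Algebra*, GTM 73 (1974), Thm. VII.4.3 [Hungerford1974].
-/

open Matrix Polynomial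
open scoped Pointwise

namespace Literature.LinearAlgebra.Matrix

/-! ## §1 Krylov matrices and the companion relation over a commutative ring -/

section Ring

variable {R : Type*} [CommRing R] {m : ℕ}

/-- `p_A = X^m + Σ_{i<m} c_i X^i`, `c_i = p_A.coeff i`, over any non-trivial commutative ring (the field case is ★ `charpoly_eq_X_pow_add_sum`).
[cite: HornJohnson2013, (3.3.11) p. 256] -/
theorem charpoly_eq_X_pow_add_sum_ring [Nontrivial R] (A : Matrix (Fin m) (Fin m) R) :
    A.charpoly = X ^ m + ∑ i : Fin m, C (A.charpoly.coeff i) * X ^ (i : ℕ) := by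
  have hmonic := A.charpoly_monic
  have hdeg : A.charpoly.natDegree = m := by rw [Matrix.charpoly_natDegree_eq_dim, Fintype.card_fin]
  conv_lhs => rw [A.charpoly.as_sum_range_C_mul_X_pow, hdeg, Finset.sum_range_succ, ← Fin.sum_univ_eq_sum_range]
  rw [add_comm]
  congr 1
  have hlc : A.charpoly.coeff m = 1 := by
    have := hmonic.leadingCoeff
    rwa [Polynomial.leadingCoeff, hdeg] at this
  rw [hlc, C_1, one_mul]

/-- Entries of `S · C(a)`: column `k` of `S C` is column `k + 1` of `S`, except the last, which is `−Σⱼ aⱼ S_{·j}` (any commutative ring).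
[cite: HornJohnson2013, (3.3.12) p. 256] -/
theorem mul_companion_apply_ring (S : Matrix (Fin m) (Fin m) R) (a : Fin m → R) (i k : Fin m) :
    (S * companion a) i k = if h : k.val + 1 = m then -∑ j, S i j * a j else S i ⟨k.val + 1, by omega⟩ := by
  rw [Matrix.mul_apply]
  split_ifs with h
  · rw [← Finset.sum_neg_distrib]
    refine Finset.sum_congr rfl fun j _ => ?_
    rw [companion_apply, if_pos h, mul_neg]
  · rw [Finset.sum_eq_single ⟨k.val + 1, by omega⟩]
    · rw [companion_apply, if_neg h, if_pos rfl, mul_one]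
    · intro j _ hj
      rw [companion_apply, if_neg h, if_neg (fun hj' => hj (Fin.ext hj')), mul_zero]
    · intro hk; exact absurd (Finset.mem_univ _) hk

/-- **`A · Kry(A, v) = Kry(A, v) · C(p_A)`** for the Krylov matrix `Kry(A, v) = [v | Av | ⋯ | A^{m−1} v]` of ANY vector `v` over any non-trivial
commutative ring (the field case is ★ `KrylovCompanionSimilarity.mul_krylov_eq_krylov_mul_companion`): columns shift, and the last column is
`A^m v = −Σ c_i A^i v` by Cayley–Hamilton. [cite: Hungerford1974, Thm VII.4.3]
[cite: HornJohnson2013, Thm 3.3.15 p. 257] -/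
theorem mul_krylov_eq_krylov_mul_companion_ring [Nontrivial R] (A : Matrix (Fin m) (Fin m) R) (v : Fin m → R) :
    A * Matrix.of (fun i k : Fin m => (A ^ (k : ℕ) *ᵥ v) i) =
      Matrix.of (fun i k : Fin m => (A ^ (k : ℕ) *ᵥ v) i) * companion fun i : Fin m => A.charpoly.coeff i := by
  -- Cayley–Hamilton: `A^m = -Σ cᵢ Aⁱ`
  have hCH : A ^ m = -∑ j : Fin m, A.charpoly.coeff j • A ^ (j : ℕ) := by
    have h := Matrix.aeval_self_charpoly A
    rw [charpoly_eq_X_pow_add_sum_ring A, map_add, map_pow, aeval_X, map_sum] at h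
    simp only [map_mul, aeval_C, map_pow, aeval_X, ← Algebra.smul_def] at h
    exact eq_neg_of_add_eq_zero_left h
  ext i k
  have lhs : (A * Matrix.of (fun i k : Fin m => (A ^ (k : ℕ) *ᵥ v) i)) i k = (A ^ ((k : ℕ) + 1) *ᵥ v) i := by
    rw [pow_succ', ← Matrix.mulVec_mulVec]
    rfl
  rw [lhs, mul_companion_apply_ring]
  split_ifs with h
  · rw [h, hCH, Matrix.neg_mulVec, show (∑ j : Fin m, A.charpoly.coeff j • A ^ (j : ℕ)) *ᵥ v =
        ∑ j : Fin m, (A.charpoly.coeff j • A ^ (j : ℕ)) *ᵥ v from map_sum (Matrix.mulVec.addMonoidHomLeft v) _ _,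
      Pi.neg_apply, Finset.sum_apply]
    congr 1
    refine Finset.sum_congr rfl fun j _ => ?_
    rw [Matrix.smul_mulVec, Pi.smul_apply, smul_eq_mul, mul_comm]
    rfl
  · rfl

end Ring

/-! ## §2 Over a local ring: a residual cyclic vector lifts -/

section Local

variable {𝒪 : Type*} [CommRing 𝒪] [IsLocalRing 𝒪] {m : ℕ}

/-- **Integral Krylov basis.**  If `g ∈ M_m(𝒪)` over a LOCAL ring has characteristic polynomial SEPARABLE modulo the maximal ideal, then
there is `S ∈ GL_m(𝒪)` (unit determinant) with `g S = S · C(p_g)`: the reduction `ḡ` is nonderogatory (★ `minpoly_eq_charpoly_of_charpoly_separable`),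
so has a cyclic vector `v̄` (★ `exists_forall_aeval_apply_eq_zero_imp`); any lift `v` gives the Krylov matrix `S = [v | gv | ⋯]`, whose determinant
is a unit because its residue `det [v̄ | ḡv̄ | ⋯]` is non-zero, and `g S = S C(p_g)` holds for every `v` (§1). [cite: Kottwitz1986, Prop. 7.1]
[cite: HornJohnson2013, Thm 3.3.15 p. 257] -/
theorem exists_isUnit_det_mul_eq_mul_companion_of_separable (g : Matrix (Fin m) (Fin m) 𝒪)
    (hsep : (g.charpoly.map (IsLocalRing.residue 𝒪)).Separable) :
    ∃ S : Matrix (Fin m) (Fin m) 𝒪, IsUnit S.det ∧ g * S = S * companion fun i : Fin m => g.charpoly.coeff i := by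
  -- the reduction `ḡ` is nonderogatory
  have hchar : (g.map (IsLocalRing.residue 𝒪)).charpoly = g.charpoly.map (IsLocalRing.residue 𝒪) := Matrix.charpoly_map g _
  have hmin : minpoly (IsLocalRing.ResidueField 𝒪) (g.map (IsLocalRing.residue 𝒪)) = (g.map (IsLocalRing.residue 𝒪)).charpoly :=
    minpoly_eq_charpoly_of_charpoly_separable _ (hchar ▸ hsep)
  have hdeg : (minpoly (IsLocalRing.ResidueField 𝒪) (Matrix.toLin' (g.map (IsLocalRing.residue 𝒪)))).natDegree = m := by
    rw [Matrix.minpoly_toLin', hmin, Matrix.charpoly_natDegree_eq_dim, Fintype.card_fin]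
  -- a residual cyclic vector
  obtain ⟨vbar, hvbar⟩ := exists_forall_aeval_apply_eq_zero_imp (Matrix.toLin' (g.map (IsLocalRing.residue 𝒪)))
  have hLI : LinearIndependent (IsLocalRing.ResidueField 𝒪)
      (fun k : Fin m => (Matrix.toLin' (g.map (IsLocalRing.residue 𝒪)) ^ (k : ℕ)) vbar) := by
    have hfun : (fun k : Fin m => (Matrix.toLin' (g.map (IsLocalRing.residue 𝒪)) ^ (k : ℕ)) vbar) =
        (fun k : Fin (minpoly (IsLocalRing.ResidueField 𝒪) (Matrix.toLin' (g.map (IsLocalRing.residue 𝒪)))).natDegree =>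
          (Matrix.toLin' (g.map (IsLocalRing.residue 𝒪)) ^ (k : ℕ)) vbar) ∘ Fin.cast hdeg.symm := by
      funext k
      rfl
    rw [hfun]
    exact (linearIndependent_pow_apply_of_forall_aeval _ vbar hvbar).comp _ (Fin.cast_injective _)
  -- lift it
  choose v hv using fun i => IsLocalRing.residue_surjective (vbar i)
  have hvfun : (IsLocalRing.residue 𝒪) ∘ v = vbar := funext hv
  refine ⟨Matrix.of fun i k : Fin m => (g ^ (k : ℕ) *ᵥ v) i, ?_, mul_krylov_eq_krylov_mul_companion_ring g v⟩
  -- the residue of the Krylov matrix is the residual Krylov matrix, which is invertible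
  have hcol : ((Matrix.of fun i k : Fin m => (g ^ (k : ℕ) *ᵥ v) i).map (IsLocalRing.residue 𝒪)).col =
      fun k : Fin m => (Matrix.toLin' (g.map (IsLocalRing.residue 𝒪)) ^ (k : ℕ)) vbar := by
    funext k i
    rw [← Matrix.toLin'_pow, Matrix.toLin'_apply, ← Matrix.map_pow, ← hvfun]
    change IsLocalRing.residue 𝒪 ((g ^ (k : ℕ) *ᵥ v) i) = _
    rw [RingHom.map_mulVec]
  have hunit : IsUnit ((Matrix.of fun i k : Fin m => (g ^ (k : ℕ) *ᵥ v) i).map (IsLocalRing.residue 𝒪)) :=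
    Matrix.linearIndependent_cols_iff_isUnit.mp (hcol ▸ hLI)
  refine (isUnit_map_iff (IsLocalRing.residue 𝒪) _).mp ?_
  rw [RingHom.map_det, RingHom.mapMatrix_apply]
  exact (Matrix.isUnit_iff_isUnit_det _).mp hunit

/-- **Integral conjugacy of regular matrices.**  Two matrices `g, g′ ∈ M_m(𝒪)` over a LOCAL ring with the SAME characteristic polynomial,
separable modulo the maximal ideal, are conjugate by an element of `GL_m(𝒪)`: `g′ P = P g` with `det P` a unit (both are integrally conjugate
to the companion matrix). [cite: Kottwitz1986, Prop. 7.1] [cite: HornJohnson2013, Thm 3.3.15 p. 257, 3.3.P12 p. 258] -/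
theorem exists_isUnit_det_conj_of_charpoly_eq (g g' : Matrix (Fin m) (Fin m) 𝒪)
    (hsep : (g.charpoly.map (IsLocalRing.residue 𝒪)).Separable) (hchar : g'.charpoly = g.charpoly) :
    ∃ P : Matrix (Fin m) (Fin m) 𝒪, IsUnit P.det ∧ g' * P = P * g := by
  obtain ⟨S, hS, hgS⟩ := exists_isUnit_det_mul_eq_mul_companion_of_separable g hsep
  obtain ⟨S', hS', hgS'⟩ := exists_isUnit_det_mul_eq_mul_companion_of_separable g' (hchar ▸ hsep)
  rw [hchar] at hgS'
  have hC : companion (fun i : Fin m => g.charpoly.coeff i) = S⁻¹ * g * S := by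
    rw [Matrix.mul_assoc, hgS, ← Matrix.mul_assoc, Matrix.nonsing_inv_mul S hS, Matrix.one_mul]
  refine ⟨S' * S⁻¹, ?_, ?_⟩
  · rw [Matrix.det_mul]
    exact hS'.mul (Matrix.isUnit_nonsing_inv_det_iff.mpr hS)
  · calc g' * (S' * S⁻¹) = g' * S' * S⁻¹ := (Matrix.mul_assoc _ _ _).symm
      _ = S' * (S⁻¹ * g * S) * S⁻¹ := by rw [hgS', hC]
      _ = S' * S⁻¹ * g := by simp only [Matrix.mul_assoc, Matrix.mul_nonsing_inv S hS, Matrix.mul_one]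

/-- **The integral commutant of `g` is `𝒪[g]`**: over a LOCAL ring, if `p_g` is separable modulo `𝔪` then every `X ∈ M_m(𝒪)` commuting
with `g` is a polynomial in `g` of degree `< m` with coefficients in `𝒪` (transport ★ `exists_eq_aeval_companion_of_commute_ring` — the
commutant of a COMPANION matrix over any commutative ring — along the integral Krylov basis; the field ∕ base-changed statement is ★
`exists_eq_aeval_map_of_commute`).  This is the interface «`Z_{M_m(𝒪)}(γ) = 𝒪[γ]`» of the unitary upgrade (norm surjectivity on the
commutant order). [cite: HornJohnson2013, Thm 3.2.4.2 p. 236, 3.3.P17 p. 260] [cite: Kottwitz1986, Prop. 7.1] -/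
theorem exists_eq_aeval_of_commute_of_separable (g : Matrix (Fin m) (Fin m) 𝒪)
    (hsep : (g.charpoly.map (IsLocalRing.residue 𝒪)).Separable) (X : Matrix (Fin m) (Fin m) 𝒪) (hX : Commute g X) :
    ∃ p : 𝒪[X], p.degree < (m : ℕ) ∧ X = aeval g p := by
  obtain ⟨S, hS, hgS⟩ := exists_isUnit_det_mul_eq_mul_companion_of_separable g hsep
  have hSS : S * S⁻¹ = 1 := Matrix.mul_nonsing_inv S hS
  have hC : companion (fun i : Fin m => g.charpoly.coeff i) = S⁻¹ * g * S := by
    rw [Matrix.mul_assoc, hgS, ← Matrix.mul_assoc, Matrix.nonsing_inv_mul S hS, Matrix.one_mul]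
  have key : ∀ M : Matrix (Fin m) (Fin m) 𝒪, S * (S⁻¹ * M * S) * S⁻¹ = M := fun M => by
    rw [Matrix.mul_assoc S⁻¹ M S, Matrix.mul_nonsing_inv_cancel_left S (M * S) hS, Matrix.mul_nonsing_inv_cancel_right S M hS]
  -- `S⁻¹ X S` commutes with the companion matrix `S⁻¹ g S`
  have hcomm : Commute (companion fun i : Fin m => g.charpoly.coeff i) (S⁻¹ * X * S) := by
    rw [hC]
    show S⁻¹ * g * S * (S⁻¹ * X * S) = S⁻¹ * X * S * (S⁻¹ * g * S)
    calc S⁻¹ * g * S * (S⁻¹ * X * S) = S⁻¹ * g * (S * S⁻¹) * X * S := by simp only [Matrix.mul_assoc]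
      _ = S⁻¹ * (g * X) * S := by rw [hSS, Matrix.mul_one]; simp only [Matrix.mul_assoc]
      _ = S⁻¹ * (X * g) * S := by rw [hX.eq]
      _ = S⁻¹ * X * (S * S⁻¹) * g * S := by rw [hSS, Matrix.mul_one]; simp only [Matrix.mul_assoc]
      _ = S⁻¹ * X * S * (S⁻¹ * g * S) := by simp only [Matrix.mul_assoc]
  obtain ⟨p, hp, hpX⟩ := exists_eq_aeval_companion_of_commute_ring _ (S⁻¹ * X * S) hcomm
  refine ⟨p, hp, ?_⟩
  rw [hC, aeval_conj_eq g S hS p] at hpX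
  calc X = S * (S⁻¹ * X * S) * S⁻¹ := (key X).symm
    _ = S * (S⁻¹ * aeval g p * S) * S⁻¹ := by rw [hpX]
    _ = aeval g p := key _

/-- Hence **the integral commutant of such a `g` is commutative**. [cite: HornJohnson2013, 3.2.P1 p. 247] -/
theorem commute_of_commute_of_separable (g : Matrix (Fin m) (Fin m) 𝒪)
    (hsep : (g.charpoly.map (IsLocalRing.residue 𝒪)).Separable) {X Y : Matrix (Fin m) (Fin m) 𝒪} (hX : Commute g X)
    (hY : Commute g Y) : Commute X Y := by
  obtain ⟨p, -, rfl⟩ := exists_eq_aeval_of_commute_of_separable g hsep X hX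
  obtain ⟨q, -, rfl⟩ := exists_eq_aeval_of_commute_of_separable g hsep Y hY
  exact (Commute.all p q).map (aeval g)

end Local

/-! ## §3 Kottwitz's orbit lemma for `GL_m`: `y (g ⊗ 1) y⁻¹` integral ⇒ `y ∈ GL_m(𝒪) · Z(g ⊗ 1)` -/

section Orbit

variable {𝒪 : Type*} [CommRing 𝒪] [IsLocalRing 𝒪] {F : Type*} [CommRing F] {m : ℕ}

/-- **`y (g ⊗ 1) y⁻¹ = g′ ⊗ 1` with `g′` integral ⇒ `y = (k ⊗ 1) · z`, `k ∈ GL_m(𝒪)`, `z ∈ Z(g ⊗ 1)`** — for `f : 𝒪 →+* F` injective (any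
commutative `F`), `g ∈ M_m(𝒪)` with characteristic polynomial separable modulo `𝔪`, and `y ∈ GL_m(F)`: the characteristic polynomials of `g′`
and `g` agree (conjugation invariance, `f` injective), so `g′ = P g P⁻¹` with `P ∈ GL_m(𝒪)` (§2) and `z := (P ⊗ 1)⁻¹ y` commutes with `g ⊗ 1`.
[cite: Kottwitz1986, Prop. 7.1] -/
theorem exists_isUnit_det_map_mul_of_conj (f : 𝒪 →+* F) (hf : Function.Injective f) {g g' : Matrix (Fin m) (Fin m) 𝒪}
    (hsep : (g.charpoly.map (IsLocalRing.residue 𝒪)).Separable) {y : Matrix (Fin m) (Fin m) F} (hy : IsUnit y.det)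
    (h : y * g.map f = g'.map f * y) :
    ∃ (k : Matrix (Fin m) (Fin m) 𝒪) (z : Matrix (Fin m) (Fin m) F),
      IsUnit k.det ∧ IsUnit z.det ∧ z * g.map f = g.map f * z ∧ y = k.map f * z := by
  -- the characteristic polynomials agree
  have hyU : IsUnit y := (Matrix.isUnit_iff_isUnit_det y).mpr hy
  have hconj : g'.map f = y * g.map f * y⁻¹ := by
    rw [h, Matrix.mul_assoc, Matrix.mul_nonsing_inv y hy, Matrix.mul_one]
  have hchar : g'.charpoly = g.charpoly := by
    apply Polynomial.map_injective f hf
    rw [← Matrix.charpoly_map, ← Matrix.charpoly_map, hconj]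
    have := Matrix.charpoly_units_conj hyU.unit (g.map f)
    rwa [hyU.unit_spec] at this
  obtain ⟨P, hP, hP'⟩ := exists_isUnit_det_conj_of_charpoly_eq g g' hsep hchar
  have hPf : IsUnit (P.map f).det := by
    rw [← RingHom.mapMatrix_apply, ← RingHom.map_det]
    exact hP.map f
  -- `g′ ⊗ 1` commutes past `P ⊗ 1`
  have hPg : g'.map f * P.map f = P.map f * g.map f := by
    rw [← Matrix.map_mul, hP', Matrix.map_mul]
  refine ⟨P, (P.map f)⁻¹ * y, hP, ?_, ?_, ?_⟩
  · rw [Matrix.det_mul]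
    exact (Matrix.isUnit_nonsing_inv_det_iff.mpr hPf).mul hy
  · -- `(P⁻¹ y) g = P⁻¹ g′ y = g P⁻¹ y`
    have hinv : (P.map f)⁻¹ * g'.map f = g.map f * (P.map f)⁻¹ := by
      calc (P.map f)⁻¹ * g'.map f = (P.map f)⁻¹ * g'.map f * (P.map f * (P.map f)⁻¹) := by
            rw [Matrix.mul_nonsing_inv _ hPf, Matrix.mul_one]
        _ = (P.map f)⁻¹ * (g'.map f * P.map f) * (P.map f)⁻¹ := by simp only [Matrix.mul_assoc]
        _ = (P.map f)⁻¹ * (P.map f * g.map f) * (P.map f)⁻¹ := by rw [hPg]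
        _ = g.map f * (P.map f)⁻¹ := by rw [← Matrix.mul_assoc, Matrix.nonsing_inv_mul _ hPf, Matrix.one_mul]
    rw [Matrix.mul_assoc, h, ← Matrix.mul_assoc, hinv, Matrix.mul_assoc]
  · rw [Matrix.mul_nonsing_inv_cancel_left _ _ hPf]

/-- **Kottwitz's orbit lemma for `GL_m` (subgroup form).**  For `f : 𝒪 →+* F` injective from a local ring, `γ ∈ GL_m(𝒪)` with characteristic
polynomial separable modulo `𝔪`, and `y ∈ GL_m(F)`: if `y (γ ⊗ 1) y⁻¹` lies in the image of `GL_m(𝒪)`, then `y ∈ im GL_m(𝒪) · Z(γ ⊗ 1)` —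
«if `g⁻¹ γ g ∈ K` then `g ∈ G_γ(F) K`» for `G = GL_m`, `K = GL_m(𝒪)`. [cite: Kottwitz1986, Prop. 7.1] -/
theorem mem_range_map_mul_centralizer_of_conj_mem_range (f : 𝒪 →+* F) (hf : Function.Injective f) (γ : GL (Fin m) 𝒪)
    (hsep : ((γ : Matrix (Fin m) (Fin m) 𝒪).charpoly.map (IsLocalRing.residue 𝒪)).Separable) (y : GL (Fin m) F)
    (h : y * Matrix.GeneralLinearGroup.map f γ * y⁻¹ ∈ (Matrix.GeneralLinearGroup.map (n := Fin m) f).range) :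
    y ∈ ((Matrix.GeneralLinearGroup.map (n := Fin m) f).range : Set (GL (Fin m) F)) *
      (Subgroup.centralizer ({Matrix.GeneralLinearGroup.map f γ} : Set (GL (Fin m) F)) : Set (GL (Fin m) F)) := by
  obtain ⟨γ', hγ'⟩ := h
  -- matrix form of the hypothesis: `y (γ ⊗ 1) = (γ′ ⊗ 1) y`
  have hval : ((Matrix.GeneralLinearGroup.map f γ' : GL (Fin m) F) : Matrix (Fin m) (Fin m) F) =
      (y : Matrix (Fin m) (Fin m) F) * (γ : Matrix (Fin m) (Fin m) 𝒪).map f * ((y⁻¹ : GL (Fin m) F) : Matrix (Fin m) (Fin m) F) := by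
    rw [hγ']
    rfl
  have hmat : (y : Matrix (Fin m) (Fin m) F) * (γ : Matrix (Fin m) (Fin m) 𝒪).map f =
      (γ' : Matrix (Fin m) (Fin m) 𝒪).map f * (y : Matrix (Fin m) (Fin m) F) := by
    have e : ((Matrix.GeneralLinearGroup.map f γ' : GL (Fin m) F) : Matrix (Fin m) (Fin m) F) = (γ' : Matrix (Fin m) (Fin m) 𝒪).map f := rfl
    rw [← e, hval, Matrix.mul_assoc, Matrix.mul_assoc, ← Units.val_mul, inv_mul_cancel, Units.val_one, Matrix.mul_one]
  have hy : IsUnit (y : Matrix (Fin m) (Fin m) F).det := (Matrix.isUnit_iff_isUnit_det _).mp y.isUnit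
  obtain ⟨k, z, hk, hz, hzg, hykz⟩ := exists_isUnit_det_map_mul_of_conj f hf hsep hy hmat
  -- package `k`, `z` as units
  have hkU : IsUnit k := (Matrix.isUnit_iff_isUnit_det k).mpr hk
  have hzU : IsUnit z := (Matrix.isUnit_iff_isUnit_det z).mpr hz
  refine Set.mem_mul.2 ⟨Matrix.GeneralLinearGroup.map f hkU.unit, ⟨hkU.unit, rfl⟩, hzU.unit, ?_, ?_⟩
  · rw [SetLike.mem_coe, Subgroup.mem_centralizer_singleton_iff]
    ext1
    change z * (γ : Matrix (Fin m) (Fin m) 𝒪).map f = (γ : Matrix (Fin m) (Fin m) 𝒪).map f * z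
    exact hzg
  · ext1
    change k.map f * z = (y : Matrix (Fin m) (Fin m) F)
    exact hykz.symm

end Orbit

end Literature.LinearAlgebra.Matrix
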